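import Summits.AtomisticToContinuum.BoseEinsteinCondensation.Theses.BECThomsonPrinciple
import Summits.AtomisticToContinuum.BoseEinsteinCondensation.Theses.BECPeriodicReduction

/-!
# Sketch — crux idea `torus-in-the-box-doob` for stmt-AtomisticToContinuum-9483 (PeriodicToDirichlet)

First lemmas of the line, typed over existing declarations (no proofs required at the idea stage):

* `TorusLocalCondensation` — where the hypothesis `A = PeriodicBEC` enters: for a rigid-translation
  invariant periodic state (the exact torus ground state is one), constant-mode occupation `n₀`
  forces flat-mode occupation `≥ n₀ / k³ = (n₀/N)·ρ|C|` on EVERY sub-cube `C` of side `L/k`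
  (PSD Cauchy–Schwarz + translation invariance of `γ`). Provable now (M).
* `InnerFlatOccupation` / `InnerFlatToBEC` — the line's Dirichlet-side target and its closing glue:
  flat-mode occupation of an INNER cube of the Dirichlet box for all `δ`-near-minimisers implies the
  conjunct (`occupation_le_maxOccupation` + `le_condensateNumber`, as `bec_of_zeroMode`). Provable now (M).
* `periodicToDirichlet_of` — the composition shape: the two Doob cruxes (K1 DoobFloor, K2
  TiltedTorusLandscape, prose in the card) + TorusLocalCondensation + ground-state pair/rigidity are to
  deliver `PeriodicBEC → InnerFlatOccupation`; with `InnerFlatToBEC` this is the crux BY NAME.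
-/

noncomputable section

namespace Summit.AtomisticToContinuum.BoseEinsteinCondensation.Cruxes.PeriodicToDirichlet.TorusInTheBox

open Literature.MathematicalPhysics.QuantumManyBody.BoseGas
open _root_.MeasureTheory _root_.Filter
open scoped ENNReal
open Summit.AtomisticToContinuum.BoseEinsteinCondensation.Theses

/-- Normalised flat mode of the sub-cube of side `L/k` with lower corner `L·j/k` (inside the cell
`[0,L)³`). -/
def subcubeMode (L : ℝ) (k : ℕ) (j : Fin 3 → Fin k) : Space → ℂ :=
  {x : Space | ∀ t, x t - L * (j t : ℕ) / k ∈ Set.Ico 0 (L / k)}.indicator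
    fun _ => ((Real.sqrt ((L / k) ^ 3))⁻¹ : ℂ)

/-- **First lemma (torus side, provable now).** For every periodic trial state invariant under
rigid translations of all particles (as the unique positive torus ground state is), the
constant-mode occupation is at most `k³` times the flat-mode occupation of ANY sub-cube of side
`L/k`: `n₀ ≤ k³ · n_{flat,C}`, i.e. `n_{flat,C} ≥ (n₀/N) · ρ|C|` — local condensation from global,
with no loss in the fraction. Proof: `γ_Ψ(x+a,y+a) = γ_Ψ(x,y)`; tile the cell by the `k³`
translates `C_i`; `n₀ L³ = Σ_{i,j} γ(C_i,C_j) ≤ (Σ_i γ(C_i,C_i)^{1/2})² = k⁶ γ(C,C)` (PSD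
Cauchy–Schwarz), and `n_{flat,C} = γ(C,C)/|C|`. This is exactly what `A` hands to the line. -/
def TorusLocalCondensation : Prop :=
  ∀ (N : ℕ) (L : ℝ), 0 < L → ∀ (k : ℕ), 0 < k → ∀ (j : Fin 3 → Fin k)
    (Ψ : PeriodicTrialState N L),
    (∀ (a : Space) (X : Config N), Ψ.ψ (fun i => X i + a) = Ψ.ψ X) →
      condensateOccupation N L Ψ.ψ ≤ (k : ℝ≥0∞) ^ 3 * cellOccupation N L (subcubeMode L k j) Ψ.ψ

/-- Normalised flat mode of the INNER cube `(θL, L-θL)³` of the Dirichlet box `Λ_L`. -/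
def innerFlatMode (θ L : ℝ) : Space → ℂ :=
  {x : Space | ∀ t, x t ∈ Set.Ioo (θ * L) (L - θ * L)}.indicator
    fun _ => ((Real.sqrt (((1 - 2 * θ) * L) ^ 3))⁻¹ : ℂ)

/-- **Dirichlet-side target of the line**: inner-cube flat-mode occupation `≥ cN` for all
`δ`-near-minimisers of the Dirichlet energy along `L_N(ρ)`, some fixed `θ ∈ (0,1/2)`. -/
def InnerFlatOccupation : Prop :=
  ∀ v : ℝ → ℝ≥0∞, IsRepulsiveFiniteRange v → ∃ ρ₀ : ℝ, 0 < ρ₀ ∧ ∀ ρ : ℝ, 0 < ρ → ρ < ρ₀ →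
    ∃ θ : ℝ, 0 < θ ∧ θ < 1 / 2 ∧ ∃ c : ℝ, 0 < c ∧ ∀ᶠ N : ℕ in atTop, ∃ δ : ℝ≥0∞, 0 < δ ∧
      ∀ Ψ : TrialState N (sideLength ρ N),
        energy v Ψ ≤ groundStateEnergy v N (sideLength ρ N) + δ →
          ENNReal.ofReal (c * N) ≤ occupation N (innerFlatMode θ (sideLength ρ N)) Ψ.ψ

/-- **Closing glue (provable now, as `bec_of_zeroMode`)**: the inner flat mode is a normalised
measurable one-body mode, so its occupation bounds `λ_max` (`occupation_le_maxOccupation`) and a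
uniform bound over `δ`-near-minimisers bounds `condensateNumber` (`le_condensateNumber`). -/
def InnerFlatToBEC : Prop :=
  InnerFlatOccupation → _root_.BoseEinsteinCondensation

/-- **What the Doob cruxes must deliver** (K1 DoobFloor + K2 TiltedTorusLandscape + torus/Dirichlet
ground-state pair + near-minimiser rigidity, see the card): the hypothesis of the crux turned into
inner-cube flat-mode occupation of the Dirichlet near-minimisers. -/
def TransferToInnerFlat : Prop :=
  BECPeriodicReduction.PeriodicBEC → InnerFlatOccupation

/-- **Composition**: the line concludes the crux by name. -/
theorem periodicToDirichlet_of (h₁ : TransferToInnerFlat) (h₂ : InnerFlatToBEC) :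
    BECThomsonPrinciple.PeriodicToDirichlet :=
  fun hA => h₂ (h₁ hA)

/-- Sanity: the crux is literally `PeriodicBEC → conjunct`. -/
example : BECThomsonPrinciple.PeriodicToDirichlet =
    (BECPeriodicReduction.PeriodicBEC → _root_.BoseEinsteinCondensation) := rfl

end Summit.AtomisticToContinuum.BoseEinsteinCondensation.Cruxes.PeriodicToDirichlet.TorusInTheBox

end
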